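import Summits.BirchSwinnertonDyer.Rank1Residual.P2.CongruentNumberSilentEvenFiveThetaCMPrinted
import Summits.BirchSwinnertonDyer.Rank1Residual.P2.CongruentNumberSilentEvenFiveThetaDescentRungTwo
import Literature.NumberTheory.EllipticCurves.TianYuanZhang2017.CMPointGaloisDisplays
import HarnessLib
import HarnessLib.Audit.Tags

/-!
# Cell «bsd-monsky» (prover-B): route B's obligation node is an INSTANCE of the Literature display
# `tyz_cmPointGaloisData` (TYZ §3.1–3.2 / Prop. 3.2 / Thm. 3.6 / p. 759 for every block of every `n`) —
# `thetaCMPrintedDatum p q` DERIVED, and the doors: C-P2-1 on `𝒮⁻` from {`tyz_cmPointGaloisData`, Aoki Thm. 2.2},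
# clause (a) from `tyz_cmPointGaloisData` ALONE, the whole even-five family from {`tyz_cmPointGaloisData`, GZK, Aoki},
# the `k = 2` rung — compositions, nothing asserted

HONEST FRAMING (cell `bsd-monsky`, run/shared/lean/pub/bsd-monsky/; README §1: ONE theorem on ONE explicit family of
quadratic twists of the congruent number curve at the prime `2`; not "BSD for rank ≤ 1"; nothing booked until the
cross-family referee passes the written proofs). This file asserts NO arithmetic fact: every door is CONDITIONAL on named
hypotheses, and C-P2-1's two `Prop`s stay `@[conjecture]`.

WHAT CHANGES. Route B's one flag of record (referee B ROUND 245: «`thetaGenusPointDatum` obligation on route B») was, after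
`P2/…ThetaCMPrinted.lean` (p408723), the node `thetaCMPrintedDatum p q := ∃ D, D.Printed ∧ thetaCMPrintedSpec D` — every
conjunct a printed TYZ §3 sentence (lit ADDENDUM 13 §D: 13/13 MATCH), but the node itself a Summits-side `@[conjecture]`
specialised to `N = 2pq`. The Literature file `TianYuanZhang2017/CMPointGaloisDisplays.lean` now displays the SAME sentences
the way the source prints them — for every square-free `n ≡ 5, 6, 7 (mod 8)` and every block `d ∣ n`, `d ≡ 5, 6, 7 (mod 8)`
— as ONE named fact `tyz_cmPointGaloisData` (which refines `tyz_genusPointData`). §1 here proves the INSTANCE: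
`CMPointGaloisPrinted D ⟹ thetaCMPrintedSpec D` at `n = 2pq` (blocks `2pq ≡ 6`, `p ≡ 5`, and `pq ≡ 7` resp. `q ≡ 7`),
hence `tyz_cmPointGaloisData ⟹ thetaCMPrintedDatum p q` for all `p ≡ 5 (mod 8)`, `q ≡ 3 (mod 4)`. The only kernel steps
are bookkeeping: `√−pq = ±i·√−p·√−q` (an automorphism fixing `i√−p` and `√−q` fixes `√−pq`); `σ²_{1+ϖ} ≡ σ` and `z^σ = z + τ(1)`
give Thm. 3.6 (2)'s "Thus `z^{σ²_{1+ϖ}} = z + τ(1)`"; an automorphism fixing `√−p` and `√p = i√−p` fixes `i`; the divisors of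
`pq` and `q`. §2: route B's doors re-fed with `tyz_cmPointGaloisData` (`hCM`):
* `analyticRank_eq_one_sMinus_of_cmPointGaloisData (hCM)` — clause (a) on `𝒮⁻` from ONE Literature display;
* `congruentSilentEvenFive{OrdTwo,BSDTwo}_of_cmPointGaloisData_of_aoki (hCM) (hAo)` — C-P2-1, both forms, on all of `𝒮⁻`
  from exactly TWO Literature named facts {TYZ §3 display, Aoki 1999 Thm. 2.2}; `…_of_monskyEven (hCM) (hMe)`;
* `analyticRank_eq_one_and_bsdp_two_three_mod_eight_of_cmPointGaloisData_of_aoki` (the `q ≡ 3 (8)` rows, either symbol);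
* `analyticRank_eq_one_and_bsdp_two_of_cmPointGaloisData_of_aoki (hCM) (hGZK) (hAo)` — `ord_{s=1} = 1 ∧ BSD(E_{2pq}, 2)` for
  ALL `p ≡ 5 (mod 8)`, `q ≡ 3 (mod 4)` from THREE binders (`hTYZ` is implied by `hCM`; Rédei–Reichardt is a tree theorem);
* §3 the `k = 2` rung of C-P2-2: `congruentSilentEvenBSDTwoAt_two_of_thetaPrinted_of_aoki (hΘ) (hAo)` (the composition
  the g5 HANDOFF left to do) and `congruentSilentEvenBSDTwoAt_two_of_cmPointGaloisData_of_aoki (hCM) (hAo)`,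
  `congruentEvenBSDTwoAt_two_of_cmPointGaloisData_of_monskyEven (hCM) (hGZK) (hMe)` (silent + loud cells).
ROUTE B'S FACT SET after this file: C-P2-1 on `𝒮⁻` relative to {`tyz_cmPointGaloisData`, `Aoki1999.thm22_card_selmerGroup_two`}
— two Literature displays of printed statements, NO Summits-side obligation node, no `hMe`, no Rédei–Reichardt, no GZK
binder, no Monsky 1990, no Tian-2014 system (honest framing of "no GZK binder" unchanged: TYZ Thm. 3.5 as displayed is
proved in print with Gross–Zagier–Kolyvagin, `…ThetaDescentRank.lean`). Nothing booked; no mark moved.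

References: [TianYuanZhang2017] §3.1 (J738–J739), Prop. 3.2, Thm. 3.6 (J741), proofs of Lemma 3.15 (J750) and Lemma 3.21
(J759), §2.1 (J725); [Aoki1999] Thm. 2.2 p. 81; [Monsky1990MockHeegner] Remark (3) p. 67; HOME/proof/PROOF-B.md (v1.3) §7;
HOME/lean/ROUTE-B-ENCLOSURE.md; HOME/lean/CMGALOIS-FAITHFULNESS.md.
-/

noncomputable section

open scoped Classical

open WeierstrassCurve WeierstrassCurve.Affine Literature.NumberTheory.EllipticCurves
  Literature.NumberTheory.EllipticCurves.Aoki1999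
  Literature.NumberTheory.EllipticCurves.Rank1Residual
  Literature.NumberTheory.EllipticCurves.Rank1Residual.Typed
  Literature.NumberTheory.EllipticCurves.HeathBrown1994
  Literature.NumberTheory.EllipticCurves.HeathBrown1994.Families
  Literature.NumberTheory.EllipticCurves.TianYuanZhang2017
  Literature.NumberTheory.EllipticCurves.TianYuanZhang2017.W2
  Literature.NumberTheory.QuadraticFields.RedeiReichardt

set_option autoImplicit false

namespace Summit.BirchSwinnertonDyer.Rank1Residual.P2

open ThetaDescent Conjectures

/-! ## §1 The instance: `CMPointGaloisPrinted D ⟹ thetaCMPrintedSpec D` at `n = 2pq` -/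

namespace ThetaDescent

variable {n : ℕ}

/-- The route-B action `thetaPt` IS the Literature display's `galPt` (both are `Affine.Point.map` of the automorphism).
[cite: TianYuanZhang2017, §3.1 (p0011 L53–L58)] -/
theorem thetaPt_eq_galPt (D : GenusPointData n) (g : D.H ≃ₐ[ℚ] D.H) : thetaPt D g = D.galPt g := rfl

/-- An automorphism fixing `x ≠ 0` and `i·x` fixes `i`. [cite: TianYuanZhang2017, proof of Lemma 3.21 (J759 = p0020 L55–L58: L_n(i) = ℚ(i, √d : d ∣ n))] -/
theorem fix_im_of_fix_mul (D : GenusPointData n) (g : D.H ≃ₐ[ℚ] D.H) {x : D.H} (hx : x ≠ 0) (hgx : g x = x)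
    (hgix : g (D.im * x) = D.im * x) : g D.im = D.im := by
  rw [map_mul, hgx] at hgix
  exact mul_right_cancel₀ hx hgix

/-- `√−d ≠ 0` in `ℍ′_n` for a divisor `d` of `n`. [cite: TianYuanZhang2017, §3.1 (p0011 L60–L64)] -/
theorem sqrtNeg_ne_zero (D : GenusPointData n) {d : ℕ} (hd : d ∈ n.divisors) : D.sqrtNeg d ≠ 0 := by
  intro h
  have hsq := D.sqrtNeg_sq d hd
  rw [h] at hsq
  have hd0 : (d : D.H) ≠ 0 := by exact_mod_cast (Nat.pos_of_mem_divisors hd).ne'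
  apply hd0
  have : ((d : ℕ) : D.H) = -((0 : D.H) ^ 2) := by rw [hsq]; ring
  rw [this]; ring

/-- **`√−pq = ±i·√−p·√−q`**: an automorphism of `ℍ′_N` fixing `i√−p` and `√−q` fixes `√−pq` (all three square roots taken in
the data). [cite: TianYuanZhang2017, §3.1 (p0011 L60–L64: K_d ⊂ L_n(i) ⊂ ℍ′_n)] -/
theorem fix_sqrtNeg_mul_of_fix {p q : ℕ} (D : GenusPointData n) (hp : p ∈ n.divisors) (hq : q ∈ n.divisors)
    (hpq : p * q ∈ n.divisors) (g : D.H ≃ₐ[ℚ] D.H) (hgp : g (D.im * D.sqrtNeg p) = D.im * D.sqrtNeg p)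
    (hgq : g (D.sqrtNeg q) = D.sqrtNeg q) : g (D.sqrtNeg (p * q)) = D.sqrtNeg (p * q) := by
  set u : D.H := D.im * D.sqrtNeg p * D.sqrtNeg q with hu
  have hu2 : u ^ 2 = D.sqrtNeg (p * q) ^ 2 := by
    rw [hu, mul_pow, mul_pow, D.im_sq, D.sqrtNeg_sq p hp, D.sqrtNeg_sq q hq, D.sqrtNeg_sq (p * q) hpq]
    push_cast; ring
  have hgu : g u = u := by rw [hu, map_mul, hgp, hgq]
  rcases sq_eq_sq_iff_eq_or_eq_neg.mp hu2.symm with h | h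
  · rw [h, hgu]
  · rw [h, map_neg, hgu]

end ThetaDescent

/-- **THE INSTANCE.** For primes `p ≡ 5 (mod 8)`, `q ≡ 3 (mod 4)` and TYZ data `D` for `N = 2pq`, the Literature display
`D.CMPointGaloisPrinted` (TYZ §3.1–3.2 / Prop. 3.2 / Thm. 3.6 / p. 759 for every block of `N`) implies route B's printed
display `thetaCMPrintedSpec D`: (N1)–(N6) are the block-`N` conjuncts (G1)–(G4), (G8) (with Thm. 3.6 (2)'s "Thus
`z^{σ²_{1+ϖ}} = z + τ(1)`" assembled from `θ² ≡ σ` and `z^σ = z + τ(1)`), (N7) is (G9) for the block `pq ≡ 7` (`q ≡ 3 (8)`;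
`√−pq = ±i√−p·√−q`) resp. `q ≡ 7`, and (P1)–(P6) are the block-`p` conjuncts (G1)–(G7), (G5), (G10) (`σ` fixes `i` because it
fixes `√−p` and `√p = i√−p`). [cite: TianYuanZhang2017, §3.1 (J738–J739), Prop. 3.2 (1)(2)(3), Thm. 3.6 (1)(2) (J741), proof of Lemma 3.21 (J759)] -/
theorem thetaCMPrintedSpec_of_cmPointGaloisPrinted {p q : ℕ} (hp : p.Prime) (hq : q.Prime) (hp5 : p % 8 = 5)
    (hq4 : q % 4 = 3) (D : GenusPointData (2 * (p * q))) (h : D.CMPointGaloisPrinted) : thetaCMPrintedSpec D := by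
  obtain ⟨z, Φ, ΓH, ΓH', σ, θ, c, ⟨hci, hcd, hcc⟩, hblk⟩ := h
  -- arithmetic of the blocks
  have hp2 : p ≠ 2 := by omega
  have hq2 : q ≠ 2 := by omega
  have hne : p ≠ q := fun h => by omega
  have hp1 : 1 < p := hp.one_lt
  have hq1 : 1 < q := hq.one_lt
  have hpodd : Odd p := hp.odd_of_ne_two hp2
  have hqodd : Odd q := hq.odd_of_ne_two hq2
  have hpqodd : Odd (p * q) := hpodd.mul hqodd
  have hN0 : 2 * (p * q) ≠ 0 := Nat.mul_ne_zero two_ne_zero (Nat.mul_ne_zero hp.ne_zero hq.ne_zero)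
  have hpq3 : (p * q) % 4 = 3 := by rw [Nat.mul_mod, show p % 4 = 1 by omega, hq4]
  have hN6 : (2 * (p * q)) % 8 = 6 := by omega
  have hN : 2 * (p * q) ∈ (2 * (p * q)).divisors := Nat.mem_divisors_self _ hN0
  have hpN : p ∈ (2 * (p * q)).divisors := Nat.mem_divisors.mpr ⟨⟨2 * q, by ring⟩, hN0⟩
  have hqN : q ∈ (2 * (p * q)).divisors := Nat.mem_divisors.mpr ⟨⟨2 * p, by ring⟩, hN0⟩
  have hpqN : p * q ∈ (2 * (p * q)).divisors := Nat.mem_divisors.mpr ⟨⟨2, by ring⟩, hN0⟩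
  have hpp : p ∈ p.divisors := Nat.mem_divisors_self _ hp.ne_zero
  have hqq : q ∈ q.divisors := Nat.mem_divisors_self _ hq.ne_zero
  have hp_pq : p ∈ (p * q).divisors := Nat.mem_divisors.mpr ⟨Dvd.intro q rfl, Nat.mul_ne_zero hp.ne_zero hq.ne_zero⟩
  have hq_pq : q ∈ (p * q).divisors :=
    Nat.mem_divisors.mpr ⟨Dvd.intro_left p rfl, Nat.mul_ne_zero hp.ne_zero hq.ne_zero⟩
  have hpq_pq : p * q ∈ (p * q).divisors := Nat.mem_divisors_self _ (Nat.mul_ne_zero hp.ne_zero hq.ne_zero)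
  -- genus roots: `√p* = i√−p`, `√q* = √−q`, `√(pq)* = √−pq`
  have hgp : D.genusRoot p = D.im * D.sqrtNeg p := by
    unfold GenusPointData.genusRoot; rw [if_pos (by omega)]
  have hgq : D.genusRoot q = D.sqrtNeg q := by
    unfold GenusPointData.genusRoot; rw [if_neg (by omega)]
  have hgpq : D.genusRoot (p * q) = D.sqrtNeg (p * q) := by
    unfold GenusPointData.genusRoot; rw [if_neg (by omega)]
  have hsp0 : D.sqrtNeg p ≠ 0 := sqrtNeg_ne_zero D hpN
  -- the three blocks
  obtain ⟨⟨hZN, hcardN⟩, hΦN, ⟨hΓN'z, -, hcommN⟩, ⟨-, hΓNgen⟩, -, ⟨-, -, hσNz⟩, -⟩ :=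
    (hblk _ hN).1 (Or.inr hN6)
  obtain ⟨hθK, ⟨m₀, h36⟩, hθH, hθθσ⟩ := (hblk _ hN).2.1 hN6
  obtain ⟨⟨hZp, hcardp⟩, hΦp, ⟨hΓp'z, hΓp'n, hcommp⟩, ⟨-, hΓpgen⟩, ⟨hdih, hcz, -⟩, ⟨hσH, hσσ, hσz⟩,
    ⟨hrep, huniq⟩⟩ := (hblk _ hpN).1 (Or.inl hp5)
  -- `σ^{(p)}` fixes `√−p`, `√p = i√−p`, hence `i`
  obtain ⟨hσsp, hσgen⟩ := hΓpgen (σ p) hσH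
  have hσrp : (σ p) (D.im * D.sqrtNeg p) = D.im * D.sqrtNeg p := by rw [← hgp]; exact hσgen p hpp hpodd hp1
  have hσi : (σ p) D.im = D.im := fix_im_of_fix_mul D (σ p) hsp0 hσsp hσrp
  refine ⟨z (2 * (p * q)), Φ (2 * (p * q)), θ (2 * (p * q)), ΓH (2 * (p * q)), ΓH' (2 * (p * q)), z p, Φ p, ΓH' p,
    σ p, c, ⟨hZN, hcardN⟩, ?_, ⟨hθK, ⟨m₀, h36⟩, ?_⟩, ⟨hΓN'z, hcommN⟩, hθH, ?_, ?_, ?_, ⟨hZp, hcardp⟩, ?_,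
    ⟨hΓp'z, hΓp'n, hcommp⟩, ⟨⟨hσi, hσrp⟩, hσσ, hσz⟩, ⟨?_, huniq⟩, ⟨hci, hcd, hcc, hdih, hcz hp5⟩⟩
  · -- (N2) `Φ₀ ⊂ Cl′_N` fixes `i` and `√−N`
    intro t ht
    exact ⟨(hΦN t ht).1, (hΦN t ht).2 _ hN (by omega)⟩
  · -- (N3) "Thus `z^{σ²_{1+ϖ}} = z + τ(1)`" from `θθσ⁻¹ ∈ Gal(ℍ′/H′_N)` and `z^σ = z + τ(1)`
    have hmul : θ (2 * (p * q)) * θ (2 * (p * q)) =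
        θ (2 * (p * q)) * θ (2 * (p * q)) * (σ (2 * (p * q)))⁻¹ * σ (2 * (p * q)) := by group
    show thetaPt D (θ _) (thetaPt D (θ _) (z _)) = z _ + tauOne
    rw [← thetaPt_mul, hmul, thetaPt_mul]
    show thetaPt D _ (D.galPt (σ _) (z _)) = _
    rw [hσNz, map_add, (thetaPt_tauOne_tauHalf D _).1]
    show D.galPt _ (z _) + tauOne = _
    rw [hΓN'z _ hθθσ]
  · -- (N6) `Gal(ℍ′/H_N)` fixes `√p = i√−p`, `√−q`, `√−pq`
    intro γ hγ
    obtain ⟨-, hgen⟩ := hΓNgen γ hγ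
    refine ⟨?_, ?_, ?_⟩
    · rw [← hgp]; exact hgen p hpN hpodd hp1
    · rw [← hgq]; exact hgen q hqN hqodd hq1
    · rw [← hgpq]; exact hgen (p * q) hpqN hpqodd (by nlinarith)
  · -- (N7), Case I: block `pq ≡ 7`
    intro hq3 g hgp' hgq'
    have hpq7 : (p * q) % 8 = 7 := by
      rw [Nat.mul_mod, hp5, hq3]
    have h7 := (hblk _ hpqN).2.2 hpq7
    have hgpq' : g (D.sqrtNeg (p * q)) = D.sqrtNeg (p * q) := fix_sqrtNeg_mul_of_fix D hpN hqN hpqN g hgp' hgq'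
    refine h7 g ⟨hgpq', ?_⟩
    intro d' hd' _ hd'1
    obtain ⟨a, b, ha, hb, rfl⟩ := (Nat.mem_divisors.mp hd').1 |> (Nat.dvd_mul.mp)
    rcases (Nat.dvd_prime hp).mp ha with rfl | rfl <;> rcases (Nat.dvd_prime hq).mp hb with rfl | rfl
    · omega
    · rw [one_mul, hgq]; exact hgq'
    · rw [mul_one, hgp]; exact hgp'
    · rw [hgpq]; exact hgpq'
  · -- (N7), Case II: block `q ≡ 7`
    intro hq7 g hgq'
    have h7 := (hblk _ hqN).2.2 hq7
    refine h7 g ⟨hgq', ?_⟩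
    intro d' hd' _ hd'1
    rcases (Nat.dvd_prime hq).mp (Nat.mem_divisors.mp hd').1 with rfl | rfl
    · omega
    · rw [hgq]; exact hgq'
  · -- (P2) `Φ₀^{(p)}` fixes `i` and `i√−p`
    intro t ht
    refine ⟨(hΦp t ht).1, ?_⟩
    rw [map_mul, (hΦp t ht).1, (hΦp t ht).2 p hpp hp1]
  · -- (P5) existence: an automorphism trivial on `L_p = ℚ(i, √p)` is trivial on `L_p(i)`
    intro g hgi hgrp
    have hgsp : g (D.sqrtNeg p) = D.sqrtNeg p := fix_of_fix_im_mul D g hgi _ hgrp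
    refine hrep g ⟨hgi, ?_⟩
    intro d' hd' hd'1
    rcases (Nat.dvd_prime hp).mp (Nat.mem_divisors.mp hd').1 with rfl | rfl
    · omega
    · exact hgsp

/-- **`tyz_cmPointGaloisData ⟹ thetaCMPrintedDatum p q`** for primes `p ≡ 5 (mod 8)`, `q ≡ 3 (mod 4)`: route B's obligation
node is an instance of the Literature display. [cite: TianYuanZhang2017, §3.1, Prop. 3.2, Thm. 3.6, proof of Lemma 3.21] -/
theorem thetaCMPrintedDatum_of_cmPointGaloisData (hCM : tyz_cmPointGaloisData) {p q : ℕ} (hp : p.Prime)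
    (hq : q.Prime) (hp5 : p % 8 = 5) (hq4 : q % 4 = 3) : thetaCMPrintedDatum p q := by
  have hpq3 : (p * q) % 4 = 3 := by rw [Nat.mul_mod, show p % 4 = 1 by omega, hq4]
  have hN6 : (2 * (p * q)) % 8 = 6 := by omega
  have hsq : Squarefree (2 * (p * q)) := (isCor515Family_two_mul_five_mul' hp hq hp5 hq4).squarefree
  obtain ⟨D, hD, hG⟩ := hCM (2 * (p * q)) hsq (Or.inr (Or.inl hN6))
  exact ⟨D, hD, thetaCMPrintedSpec_of_cmPointGaloisPrinted hp hq hp5 hq4 D hG⟩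

/-- The family form consumed by the doors of `…ThetaCMPrinted.lean`. [cite: TianYuanZhang2017, §3] -/
theorem thetaPrinted_of_cmPointGaloisData (hCM : tyz_cmPointGaloisData) :
    ∀ p q : ℕ, p.Prime → q.Prime → p % 8 = 5 → q % 4 = 3 → thetaCMPrintedDatum p q :=
  fun _ _ hp hq hp5 hq4 => thetaCMPrintedDatum_of_cmPointGaloisData hCM hp hq hp5 hq4

/-- And the original display `K_B = thetaGenusPointDatum` for all pairs. [cite: TianYuanZhang2017, §3] -/
theorem thetaDisplay_of_cmPointGaloisData (hCM : tyz_cmPointGaloisData) :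
    ∀ p q : ℕ, p.Prime → q.Prime → p % 8 = 5 → q % 4 = 3 → thetaGenusPointDatum p q :=
  thetaDisplay_of_thetaPrinted (thetaPrinted_of_cmPointGaloisData hCM)

/-! ## §2 Doors: C-P2-1 and clause (a) on `𝒮⁻`, the `q ≡ 3 (8)` rows, the whole even-five family -/

/-- **Clause (a) on `𝒮⁻` from ONE Literature display**: `ord_{s=1} L(E_{2pq}, s) = 1` for every `(p, q) ∈ 𝒮⁻`, relative to
`tyz_cmPointGaloisData` alone (`g(2pq)` odd and Rédei–Reichardt are tree theorems; no Selmer input, no GZK binder — honest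
framing in `…ThetaDescentRank.lean`). CONDITIONAL; nothing asserted. [cite: TianYuanZhang2017, Thm. 3.5, Prop. 3.2, Thm. 3.6, Lemma 3.21] -/
theorem analyticRank_eq_one_sMinus_of_cmPointGaloisData (hCM : tyz_cmPointGaloisData)
    {p q : ℕ} (hp : p.Prime) (hq : q.Prime) (hp5 : p % 8 = 5) (hq4 : q % 4 = 3) (hj : jacobiSym p q = -1) :
    (congruentNumberCurve (2 * (p * q))).analyticRank = 1 :=
  analyticRank_eq_one_sMinus_of_thetaPrinted (thetaPrinted_of_cmPointGaloisData hCM) hp hq hp5 hq4 hj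

/-- **C-P2-1, sharper (`Ш_an`-unit) form, on all of `𝒮⁻` from {`tyz_cmPointGaloisData`, Aoki 1999 Thm. 2.2}** — two Literature
named facts. CONDITIONAL; nothing asserted. [cite: Aoki1999, Thm. 2.2 p. 81] [cite: TianYuanZhang2017, Thm. 3.5, Prop. 3.2, Thm. 3.6] -/
theorem congruentSilentEvenFiveOrdTwo_of_cmPointGaloisData_of_aoki (hCM : tyz_cmPointGaloisData)
    (hAo : thm22_card_selmerGroup_two) : CongruentSilentEvenFiveOrdTwo :=
  congruentSilentEvenFiveOrdTwo_of_thetaPrinted_of_aoki (thetaPrinted_of_cmPointGaloisData hCM) hAo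

/-- **C-P2-1, OBSERVABLE form (`ord_{s=1} L(E_{2pq}, s) = 1 ∧ BSD(E_{2pq}, 2)` on all of `𝒮⁻`) from exactly TWO Literature
named facts {`tyz_cmPointGaloisData` (TYZ §3 as printed), `Aoki1999.thm22_card_selmerGroup_two` (Aoki Thm. 2.2)}** — no
Summits-side obligation node, no `hMe`, no Rédei–Reichardt, no GZK binder, no Monsky 1990, no Tian-2014 system.
CONDITIONAL; nothing asserted; no mark moved. [cite: Aoki1999, Thm. 2.2 p. 81] [cite: TianYuanZhang2017, Thm. 3.5, Prop. 3.2, Thm. 3.6, Lemma 3.21] -/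
theorem congruentSilentEvenFiveBSDTwo_of_cmPointGaloisData_of_aoki (hCM : tyz_cmPointGaloisData)
    (hAo : thm22_card_selmerGroup_two) : CongruentSilentEvenFiveBSDTwo :=
  congruentSilentEvenFiveBSDTwo_of_thetaPrinted_of_aoki (thetaPrinted_of_cmPointGaloisData hCM) hAo

/-- **C-P2-1, observable form, from {`tyz_cmPointGaloisData`, `hMe`}** (Heath-Brown 1994 / Monsky's even `2`-Selmer count
instead of Aoki). CONDITIONAL; nothing asserted. [cite: HeathBrown1994SelmerCongruentII, Appendix (Monsky) p. 41 L20–L36]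
[cite: TianYuanZhang2017, Thm. 3.5, Prop. 3.2, Thm. 3.6] -/
theorem congruentSilentEvenFiveBSDTwo_of_cmPointGaloisData_of_monskyEven (hCM : tyz_cmPointGaloisData)
    (hMe : monsky_card_selmerGroup_two_even) : CongruentSilentEvenFiveBSDTwo :=
  congruentSilentEvenFiveBSDTwo_of_thetaPrinted_of_monskyEven (thetaPrinted_of_cmPointGaloisData hCM) hMe

/-- **`ord_{s=1} L(E_{2pq}, s) = 1 ∧ BSD(E_{2pq}, 2)` for every `p ≡ 5 (mod 8)`, `q ≡ 3 (mod 8)`, EITHER symbol**, from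
{`tyz_cmPointGaloisData`, Aoki 1999 Thm. 2.2}. CONDITIONAL; nothing asserted. [cite: Aoki1999, Thm. 2.2 p. 81]
[cite: TianYuanZhang2017, Thm. 3.5, Prop. 3.2, Thm. 3.6] -/
theorem analyticRank_eq_one_and_bsdp_two_three_mod_eight_of_cmPointGaloisData_of_aoki (hCM : tyz_cmPointGaloisData)
    (hAo : thm22_card_selmerGroup_two) {p q : ℕ} (hp : p.Prime) (hq : q.Prime) (hp5 : p % 8 = 5) (hq3 : q % 8 = 3) :
    (congruentNumberCurve (2 * (p * q))).analyticRank = 1 ∧ BSDp (congruentNumberCurve (2 * (p * q))) 2 :=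
  analyticRank_eq_one_and_bsdp_two_three_mod_eight_of_thetaPrinted_of_aoki (thetaPrinted_of_cmPointGaloisData hCM) hAo
    hp hq hp5 hq3

/-- **`ord_{s=1} L(E_{2pq}, s) = 1 ∧ BSD(E_{2pq}, 2)` for ALL primes `p ≡ 5 (mod 8)`, `q ≡ 3 (mod 4)` from THREE binders
{`tyz_cmPointGaloisData`, GZK, Aoki 1999 Thm. 2.2}**: on `(p/q) = +1` Tian–Yuan–Zhang's own descent (U⁺, the tree theorem
`W2.uPlus_genusField_of` fed with `tyz_genusPointData_of_cmPointGaloisData hCM`) through prover-A's door, on `(p/q) = −1` route B;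
Rédei–Reichardt is the tree theorem `redeiReichardt_fourTwoCard_classGroup_holds`. CONDITIONAL; nothing asserted; no mark moved.
[cite: TianYuanZhang2017, Thm. 1.2, Thm. 3.5, Prop. 3.2, Thm. 3.6] [cite: Aoki1999, Thm. 2.2 p. 81] -/
theorem analyticRank_eq_one_and_bsdp_two_of_cmPointGaloisData_of_aoki (hCM : tyz_cmPointGaloisData)
    (hGZK : rank_eq_analyticRank_of_analyticRank_le_one) (hAo : thm22_card_selmerGroup_two)
    {p q : ℕ} (hp : p.Prime) (hq : q.Prime) (hp5 : p % 8 = 5) (hq4 : q % 4 = 3) :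
    (congruentNumberCurve (2 * (p * q))).analyticRank = 1 ∧ BSDp (congruentNumberCurve (2 * (p * q))) 2 := by
  have hne : p ≠ q := fun h => by omega
  rcases jacobiSym.eq_one_or_neg_one (int_gcd_eq_one_of_primes hp hq hne) with hj | hj
  · exact bsdp_two_congruentNumberCurve_two_mul_five_mul_of_aoki (tyz_genusPointData_of_cmPointGaloisData hCM) hGZK
      redeiReichardt_fourTwoCard_classGroup_holds hAo hp hq hp5 hq4 hj
  · exact congruentSilentEvenFiveBSDTwo_of_cmPointGaloisData_of_aoki hCM hAo p q hp hq hp5 hq4 hj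

/-- **`BSD(E_{2pq}, 2)` on the whole even-five family** from {`tyz_cmPointGaloisData`, GZK, Aoki 1999 Thm. 2.2} (the shape of
the consumer door `forall_bsdp_two_congruentNumberCurve_two_mul_five_mul`). CONDITIONAL; nothing asserted.
[cite: TianYuanZhang2017, Thm. 1.2, Thm. 3.5, Prop. 3.2, Thm. 3.6] [cite: Aoki1999, Thm. 2.2 p. 81] -/
theorem forall_bsdp_two_congruentNumberCurve_two_mul_five_mul_of_cmPointGaloisData_of_aoki
    (hCM : tyz_cmPointGaloisData) (hGZK : rank_eq_analyticRank_of_analyticRank_le_one)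
    (hAo : thm22_card_selmerGroup_two) :
    ∀ p q : ℕ, p.Prime → q.Prime → p % 8 = 5 → q % 4 = 3 → BSDp (congruentNumberCurve (2 * (p * q))) 2 :=
  fun _ _ hp hq hp5 hq4 => (analyticRank_eq_one_and_bsdp_two_of_cmPointGaloisData_of_aoki hCM hGZK hAo hp hq hp5 hq4).2

/-! ## §3 The `k = 2` rung of the typed uniform law C-P2-2 -/

/-- **THE SILENT `k = 2` RUNG from {printed display `thetaCMPrintedDatum`, Aoki Thm. 2.2}** (the composition left open by the
g5 HANDOFF: `…RungTwo`'s `_of_thetaDisplay_of_aoki` fed with `thetaDisplay_of_thetaPrinted`). Conditional; nothing asserted.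
[cite: Monsky1990MockHeegner, Remark (3) (p. 67)] [cite: TianYuanZhang2017, Prop. 3.2, Thm. 3.6, Thm. 3.5] [cite: Aoki1999, Thm. 2.2 (p. 81)] -/
theorem congruentSilentEvenBSDTwoAt_two_of_thetaPrinted_of_aoki
    (hΘ : ∀ p q : ℕ, p.Prime → q.Prime → p % 8 = 5 → q % 4 = 3 → thetaCMPrintedDatum p q)
    (hAo : thm22_card_selmerGroup_two) : CongruentSilentEvenBSDTwoAt 2 :=
  congruentSilentEvenBSDTwoAt_two_of_thetaDisplay_of_aoki (thetaDisplay_of_thetaPrinted hΘ) hAo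

/-- **THE SILENT `k = 2` RUNG from {`tyz_cmPointGaloisData`, Aoki Thm. 2.2}** — two Literature named facts. Conditional;
nothing asserted. [cite: Monsky1990MockHeegner, Remark (3) (p. 67)] [cite: TianYuanZhang2017, Prop. 3.2, Thm. 3.6, Thm. 3.5]
[cite: Aoki1999, Thm. 2.2 (p. 81)] -/
theorem congruentSilentEvenBSDTwoAt_two_of_cmPointGaloisData_of_aoki (hCM : tyz_cmPointGaloisData)
    (hAo : thm22_card_selmerGroup_two) : CongruentSilentEvenBSDTwoAt 2 :=
  congruentSilentEvenBSDTwoAt_two_of_thetaDisplay_of_aoki (thetaDisplay_of_cmPointGaloisData hCM) hAo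

/-- **THE `k = 2` RUNG `CongruentEvenBSDTwoAt 2` (silent AND loud cells) from {`tyz_cmPointGaloisData`, GZK, `hMe`}** — U⁺ is
the tree theorem `W2.uPlus_genusField_of` on `tyz_genusPointData_of_cmPointGaloisData hCM`; `hMe` is the currency of the
cell condition `s(n) = 1` on the loud cells (DOOR B6). Conditional; nothing asserted.
[cite: Monsky1990MockHeegner, Remark (3) (p. 67)] [cite: TianYuanZhang2017, Thm. 1.2, Thm. 3.5, Prop. 3.2, Thm. 3.6]
[cite: HeathBrown1994SelmerCongruentII, Appendix (Monsky)] [cite: Miller2011LMS, Def. 1.1 (arXiv:1010.2431 p. 3)] -/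
theorem congruentEvenBSDTwoAt_two_of_cmPointGaloisData_of_monskyEven (hCM : tyz_cmPointGaloisData)
    (hGZK : rank_eq_analyticRank_of_analyticRank_le_one) (hMe : monsky_card_selmerGroup_two_even) :
    CongruentEvenBSDTwoAt 2 :=
  congruentEvenBSDTwoAt_two_of_thetaDisplay_of_monskyEven
    (uPlus_of_genusPointData (tyz_genusPointData_of_cmPointGaloisData hCM) hGZK) hGZK
    (thetaDisplay_of_cmPointGaloisData hCM) hMe

end Summit.BirchSwinnertonDyer.Rank1Residual.P2

end
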